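import Summits.Parity.GeneralizedHardyLittlewood.Theses.RealCharacterFortyBillion

/-! # Assembly of route `RealCharacterFortyBillion` (stmt-Parity-20173)

The route's `Assembly` item is exactly the curried deciding theorem `closes`
(parity split `NoRealZeroUpTo.iff_odd_and_even` + range split at 35 180 000 000). -/

namespace Summit.Parity.GeneralizedHardyLittlewood.Theorems

open Summit.Parity.GeneralizedHardyLittlewood.Theses.RealCharacterFortyBillion in
/-- **Assembly of route `RealCharacterFortyBillion` (stmt-Parity-20173).** The route's `Assembly`
(`ToThirtyBillion → OddSegmentLow → OddSegmentHigh → EvenSegmentLow → EvenSegmentHigh →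
NoRealZeroUpTo 40000000000`) is the route file's curried deciding theorem `closes` (parity split
`NoRealZeroUpTo.iff_odd_and_even` and the range split at `35 180 000 000`). -/
theorem realCharacterFortyBillion_assembly :
    Summit.Parity.GeneralizedHardyLittlewood.Theses.RealCharacterFortyBillion.Assembly :=
  fun h30 hol hoh hel heh => closes h30 hol hoh hel heh

end Summit.Parity.GeneralizedHardyLittlewood.Theorems
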